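import Summits.CriticalPhenomena.CardyFormulaZ2.Theorems.SymmetryUpgradeR.Negative.DiracChordsTrace
import Literature.Probability.RandomPlanarGeometry.CurveClassStopAtMeasurable
import HarnessLib

/-!
# Deterministic simple chords, III: the typed domain Markov property is automatic

Crux `SymmetryUpgradeR` (stmt-CriticalPhenomena-17239, route `CardySelfRefinement`), line `SketchIdeatorTwo`,
negative side: the lead's structural theorem behind the verdict on stubs S7 `stub_pinnedSchrammLSW` /
S5a `stub_middleDrivingMartingale` — the typed domain Markov property `ChordalFamily.IsDomainMarkov`
cannot carry Schramm's increment argument (headline in `TiltedRayFamily.lean`: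
`typedSchrammPrinciple_fails`).

The typed domain Markov property (`ChordalCurveFamily.lean`: a kernel `Q D past` with `initial`, the
disintegration `markov` at first hittings of closed sets, and `domain`: `Q D past` depends on
`(D, past)` only through `(remainingDomain D past, past.target, D.pt 1)`) is DEGENERATE on
deterministic simple chord families: `D ↦ δ_{[c D]}` is domain Markov (`isDomainMarkov_dirac`). The
point (`mk_fut_eq_of_realises`): an explored configuration `(remaining domain, tip, target)` determines
`(D.carrier, a, b)` — the carrier as `interior (closure ·)` of the remaining domain, the slit as its
complement in the carrier, `a` as the extra point of the slit's closure — hence the chord up to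
reparametrisation, hence its future after the tip. So "the conditional law of the future is a function
of the remaining configuration" asks nothing beyond consistency at boundary renewals, which injective
deterministic chords meet trivially; no value of the family in a slit domain and no conformal structure
enter. The kernel `diracKernel` is defined from the triple by choice (as `sleMarkovKernel` is).

References: W. Werner, *Lectures on two-dimensional critical percolation* (2007), §3.2 (2), Lemma 3.3;
O. Schramm, Israel J. Math. 118 (2000), §1; G. F. Lawler, *Conformally Invariant Processes in the Plane*
(2005), §6.3.
-/

noncomputable section

open Set MeasureTheory Topology Filter Metric
open scoped unitInterval ENNReal NNReal
open UpperHalfPlane (upperHalfPlaneSet)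

namespace Summit.CriticalPhenomena.CardyFormulaZ2.Theorems.SymmetryUpgradeR.Negative

open Literature.Probability.RandomPlanarGeometry Literature.Probability.RandomPlanarGeometry.ChordalFamily

/-! ### The kernel of a deterministic family and its rigidity -/

/-- The configuration `(D, r)` — the chord of `D` explored up to parameter `r` — **realises** the
triple `(U, z, b)`: remaining domain `U`, tip `z`, target `b`. [folklore] -/
def Realises (c : DobrushinDomain → Curve ℂ) (D : DobrushinDomain) (r : ℝ) (U : Set ℂ) (z b : ℂ) :
    Prop :=
  r ∈ Icc (0 : ℝ) 1 ∧ remainingDomain D (CurveClass.mk (segCurve (c D) 0 r)) = U ∧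
    segCurve (c D) 0 r 1 = z ∧ D.pt 1 = b

open Classical in
/-- The **kernel of the deterministic family** `D ↦ δ_{[c D]}` on explored configurations: Dirac mass
at the future of (a choice of) a configuration realising `(remainingDomain D past, past.target, b)`;
`0` if there is none. A function of the triple by construction. [folklore] -/
def diracKernel (c : DobrushinDomain → Curve ℂ) (D : DobrushinDomain) (past : CurveClass ℂ) :
    Measure (CurveClass ℂ) :=
  if h : ∃ q : DobrushinDomain × ℝ, Realises c q.1 q.2 (remainingDomain D past) past.target (D.pt 1)
  then Measure.dirac (CurveClass.mk (segCurve (c h.choose.1) h.choose.2 (1 - h.choose.2)))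
  else 0

/-- The kernel depends on `(D, past)` only through the triple. [folklore] -/
theorem diracKernel_domain (c : DobrushinDomain → Curve ℂ) (D₁ D₂ : DobrushinDomain)
    (p₁ p₂ : CurveClass ℂ) (hU : remainingDomain D₁ p₁ = remainingDomain D₂ p₂)
    (hz : p₁.target = p₂.target) (hb : D₁.pt 1 = D₂.pt 1) :
    diracKernel c D₁ p₁ = diracKernel c D₂ p₂ := by
  unfold diracKernel
  rw [hU, hz, hb]

namespace IsSimpleChordFamily

variable {c : DobrushinDomain → Curve ℂ} (hc : IsSimpleChordFamily c)
include hc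

/-- **Rigidity**: two configurations realising the same triple have the same future. [folklore] -/
theorem mk_fut_eq_of_realises {D₁ D₂ : DobrushinDomain} {r₁ r₂ : ℝ} {U : Set ℂ} {z b : ℂ}
    (h₁ : Realises c D₁ r₁ U z b) (h₂ : Realises c D₂ r₂ U z b) :
    CurveClass.mk (segCurve (c D₁) r₁ (1 - r₁)) = CurveClass.mk (segCurve (c D₂) r₂ (1 - r₂)) := by
  obtain ⟨hr₁, hU₁, hz₁, hb₁⟩ := h₁
  obtain ⟨hr₂, hU₂, hz₂, hb₂⟩ := h₂
  have htip₁ : c D₁ ⟨r₁, hr₁⟩ = z := by rw [← segCurve_zero_apply_one]; exact hz₁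
  have htip₂ : c D₂ ⟨r₂, hr₂⟩ = z := by rw [← segCurve_zero_apply_one]; exact hz₂
  -- the degenerate configurations: tip at the target
  have hdeg : ∀ {D D' : DobrushinDomain} {r r' : ℝ} (hr : r ∈ Icc (0 : ℝ) 1) (hr' : r' ∈ Icc (0 : ℝ) 1),
      c D ⟨r, hr⟩ = z → c D' ⟨r', hr'⟩ = z → D.pt 1 = b → D'.pt 1 = b → r = 1 → r' = 1 := by
    intro D D' r r' hr hr' ht ht' hbD hbD' h1
    subst h1
    have hzb : z = b := by
      rw [← ht, ← hbD, ← hc.apply_one D]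
      rfl
    have : (⟨r', hr'⟩ : I) = 1 := hc.eq_one_of_apply_eq_pt_one D' (by rw [ht', hzb, hbD'])
    exact congrArg Subtype.val this
  rcases eq_or_lt_of_le hr₁.2 with h1 | hlt₁
  · have h2 : r₂ = 1 := hdeg hr₁ hr₂ htip₁ htip₂ hb₁ hb₂ h1
    subst h1; subst h2
    rw [sub_self, segCurve_one_zero, segCurve_one_zero, hc.apply_one, hc.apply_one, hb₁, hb₂]
  rcases eq_or_lt_of_le hr₂.2 with h2 | hlt₂
  · exact absurd (hdeg hr₂ hr₁ htip₂ htip₁ hb₂ hb₁ h2) hlt₁.ne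
  -- generic configurations: the remaining domain is the carrier minus the slit
  set S₁ := c D₁ '' {s : I | 0 < (s : ℝ) ∧ (s : ℝ) ≤ r₁} with hS₁
  set S₂ := c D₂ '' {s : I | 0 < (s : ℝ) ∧ (s : ℝ) ≤ r₂} with hS₂
  have hW₁ : D₁.carrier \ S₁ = U := by rw [← hU₁, hc.remainingDomain_eq D₁ hr₁ hlt₁]
  have hW₂ : D₂.carrier \ S₂ = U := by rw [← hU₂, hc.remainingDomain_eq D₂ hr₂ hlt₂]
  -- the carriers agree
  have hV : D₁.carrier = D₂.carrier := by
    rw [hc.carrier_eq_interior_closure D₁ hlt₁, hc.carrier_eq_interior_closure D₂ hlt₂]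
    change interior (closure (D₁.carrier \ S₁)) = interior (closure (D₂.carrier \ S₂))
    rw [hW₁, hW₂]
  -- the slits agree
  have hS : S₁ = S₂ := by
    have e₁ : D₁.carrier \ (D₁.carrier \ S₁) = S₁ := Set.sdiff_sdiff_cancel_left (hc.slit_subset D₁ hlt₁)
    have e₂ : D₂.carrier \ (D₂.carrier \ S₂) = S₂ := Set.sdiff_sdiff_cancel_left (hc.slit_subset D₂ hlt₂)
    rw [← e₁, ← e₂, hW₁, hW₂, hV]
  -- the starting points agree
  have hslit_nonempty : ∀ {D : DobrushinDomain} {r : ℝ} (hr : r ∈ Icc (0 : ℝ) 1), 0 < r →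
      c D ⟨r, hr⟩ ∈ c D '' {s : I | 0 < (s : ℝ) ∧ (s : ℝ) ≤ r} :=
    fun hr h0 => ⟨⟨_, hr⟩, ⟨h0, le_rfl⟩, rfl⟩
  have ha : D₁.pt 0 = D₂.pt 0 := by
    rcases eq_or_lt_of_le hr₁.1 with h01 | h01
    · -- `r₁ = 0`: both slits are empty, both tips are the starting points
      have hS₁e : S₁ = ∅ := by
        rw [hS₁, Set.image_eq_empty]
        ext s
        simp only [mem_setOf_eq, mem_empty_iff_false, iff_false, not_and, not_le]
        intro hs
        rw [← h01]
        exact hs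
      have h02 : r₂ = 0 := by
        by_contra hne
        have hpos : 0 < r₂ := lt_of_le_of_ne hr₂.1 (Ne.symm hne)
        have := hslit_nonempty (D := D₂) hr₂ hpos
        rw [← hS₂, ← hS, hS₁e] at this
        exact this
      have e₁ : (⟨r₁, hr₁⟩ : I) = 0 := Subtype.ext h01.symm
      have e₂ : (⟨r₂, hr₂⟩ : I) = 0 := Subtype.ext h02
      rw [← hc.apply_zero D₁, ← hc.apply_zero D₂]
      rw [e₁] at htip₁
      rw [e₂] at htip₂
      rw [htip₁, htip₂]
    · have h02 : 0 < r₂ := by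
        by_contra hle
        have h0 : r₂ = 0 := le_antisymm (not_lt.1 hle) hr₂.1
        have hS₂e : S₂ = ∅ := by
          rw [hS₂, Set.image_eq_empty]
          ext s
          simp only [mem_setOf_eq, mem_empty_iff_false, iff_false, not_and, not_le]
          intro hs
          rw [h0]
          exact hs
        have := hslit_nonempty (D := D₁) hr₁ h01
        rw [← hS₁, hS, hS₂e] at this
        exact this
      have k₁ := hc.closure_slit_diff_carrier D₁ h01 hr₁ hlt₁
      have k₂ := hc.closure_slit_diff_carrier D₂ h02 hr₂ hlt₂
      rw [← hS₁] at k₁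
      rw [← hS₂, ← hS, ← hV, k₁] at k₂
      exact singleton_eq_singleton_iff.1 k₂
  -- hence the chords agree up to reparametrisation, the tips at corresponding parameters
  obtain ⟨φ, hφ⟩ := hc.exists_reparam D₁ D₂ hV ha (hb₁.trans hb₂.symm)
  have hpar : φ ⟨r₂, hr₂⟩ = ⟨r₁, hr₁⟩ := by
    apply hc.injective D₁
    rw [htip₁, ← Curve.reparam_apply, ← hφ, htip₂]
  rw [hφ]
  exact (mk_segCurve_reparam (c D₁) φ hr₁ hr₂ hlt₁ hlt₂ hpar).symm

/-- **The kernel at an explored initial piece of the chord** is the Dirac mass at its future. [folklore] -/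
theorem diracKernel_mk_segCurve (D : DobrushinDomain) {r : ℝ} (hr : r ∈ Icc (0 : ℝ) 1) :
    diracKernel c D (CurveClass.mk (segCurve (c D) 0 r)) =
      Measure.dirac (CurveClass.mk (segCurve (c D) r (1 - r))) := by
  classical
  have hD : Realises c D r (remainingDomain D (CurveClass.mk (segCurve (c D) 0 r)))
      (CurveClass.mk (segCurve (c D) 0 r)).target (D.pt 1) := by
    unfold Realises
    exact ⟨hr, rfl, rfl, rfl⟩
  have h : ∃ q : DobrushinDomain × ℝ, Realises c q.1 q.2
      (remainingDomain D (CurveClass.mk (segCurve (c D) 0 r)))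
      (CurveClass.mk (segCurve (c D) 0 r)).target (D.pt 1) :=
    ⟨(D, r), hD⟩
  rw [diracKernel, dif_pos h]
  congr 1
  exact hc.mk_fut_eq_of_realises h.choose_spec hD

/-- **The deterministic family is a Markov extension of itself through `diracKernel`.** [folklore] -/
theorem isMarkovExtension_diracKernel :
    ChordalFamily.IsMarkovExtension (fun D => Measure.dirac (CurveClass.mk (c D))) (diracKernel c) where
  initial D := by
    have h0 : CurveClass.mk (Curve.const (D.pt 0)) = CurveClass.mk (segCurve (c D) 0 0) := by
      rw [segCurve_zero_zero, hc.apply_zero]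
    change diracKernel c D _ = Measure.dirac (CurveClass.mk (c D))
    rw [h0, hc.diracKernel_mk_segCurve D ⟨le_rfl, zero_le_one⟩, sub_zero, segCurve_zero_one]
  markov D F hF S T hS hT := by
    classical
    set x := CurveClass.mk (c D) with hx
    have hr := (c D).hitParam_mem_Icc F
    have hstop : CurveClass.stopAt F x = CurveClass.mk (segCurve (c D) 0 ((c D).hitParam F)) := by
      rw [hx, CurveClass.stopAt_mk_holds F hF (c D), stopAt_eq_segCurve]
    have hstart : CurveClass.startFrom F x =
        CurveClass.mk (segCurve (c D) ((c D).hitParam F) (1 - (c D).hitParam F)) := by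
      rw [hx, CurveClass.startFrom_mk_holds F hF (c D), startFrom_eq_segCurve]
    change Measure.dirac x _ = ∫⁻ γ in _, diracKernel c D (CurveClass.stopAt F γ) T ∂(Measure.dirac x)
    rw [setLIntegral_dirac]
    have hmeas := (CurveClass.measurableSet_stopAt_preimage hF hS).inter
      (CurveClass.measurableSet_startFrom_preimage hF hT)
    rw [Measure.dirac_apply' _ hmeas]
    by_cases hA : x ∈ CurveClass.stopAt F ⁻¹' S
    · rw [if_pos hA, hstop, hc.diracKernel_mk_segCurve D hr, Measure.dirac_apply' _ hT, ← hstart]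
      by_cases hB : x ∈ CurveClass.startFrom F ⁻¹' T
      · rw [indicator_of_mem (show x ∈ CurveClass.stopAt F ⁻¹' S ∩ CurveClass.startFrom F ⁻¹' T from ⟨hA, hB⟩),
          indicator_of_mem (show CurveClass.startFrom F x ∈ T from hB)]
        rfl
      · rw [indicator_of_notMem (fun h => hB h.2),
          indicator_of_notMem (show CurveClass.startFrom F x ∉ T from hB)]
    · rw [if_neg hA, indicator_of_notMem (fun h => hA h.1)]
  domain D₁ D₂ p₁ p₂ hU hz hb := diracKernel_domain c D₁ D₂ p₁ p₂ hU hz hb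

/-- **Deterministic simple chords are domain Markov (typed form).** [folklore] -/
theorem isDomainMarkov_dirac :
    ChordalFamily.IsDomainMarkov (fun D => Measure.dirac (CurveClass.mk (c D))) :=
  ⟨diracKernel c, hc.isMarkovExtension_diracKernel⟩

end IsSimpleChordFamily

/-- Registered form (crux stmt-CriticalPhenomena-17239, `--supports`): **deterministic simple chords are
domain Markov in the typed sense.** [folklore] -/
theorem dirac_isDomainMarkov :
    ∀ c : DobrushinDomain → Curve ℂ, IsSimpleChordFamily c →
      ChordalFamily.IsDomainMarkov (fun D => Measure.dirac (CurveClass.mk (c D))) :=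
  fun _ hc => hc.isDomainMarkov_dirac

end Summit.CriticalPhenomena.CardyFormulaZ2.Theorems.SymmetryUpgradeR.Negative

end
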